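import Mathlib.Data.Real.Basic
import Mathlib.Tactic.Linarith
import Mathlib.Tactic.Positivity
import Mathlib.Tactic.FieldSimp
import Mathlib.Tactic.Ring
import HarnessLib
import Summits.CriticalPhenomena.PercolationContinuityZ3.Theorems.PercNearOneGluingNoHeavyLowerTailSahiT2SquareRemainders

/-!
# `NoHeavyLowerTail` (crux stmt-CriticalPhenomena-4575), P2 — THE `(2,2)` ATOM: REMAINDER BOUNDS AT THE CORNER `(0,1)` AND THE JOINT BOUND AT `(0,0)`

Seat `prim-masterthm-p2`, gen 29 (memo §9; `--supports stmt-CriticalPhenomena-4575`). Continues `…SahiT2SquareRemainders` (same data and notation):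
`R_01 = aD_T0(H̄_C) + dD_ZC(H̄_C) − κ_C0(H̄_T−H̄_C) + κ_TC(H̄_C−H̄_0) ≥ 0` (`t2R01_*`) and the JOINT corner-`(0,0)` bound
`R_00 + R_e1 + R_e2 ≥ 0` with `R_00 = aD_T0(H̄_0) + dD_ZC(H̄_0) − κ_Z0(H̄_C−H̄_0) − κ_C0(H̄_Z−H̄_0)` and the edge remainders abstracted as
`Re1 ≥ κ_Z0(H̄_Z−H̄_0)`, `Re2 ≥ κ_C0(H̄_C−H̄_0)` (supplied by `t2edgeR` under the edge rule `(0, 1−F_lo/F_hi)`) (`t2R00joint_*`).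
This is the Bernstein-coefficient `β₁₁` of the `(2,2)` expansion (memo §9): the corner atom `I3_00` alone is NOT certifiable by a single box identity. [this work]
-/

noncomputable section

namespace Summit.CriticalPhenomena.PercolationContinuityZ3.Theorems

namespace SahiT2Square

section Corner00

variable {F0 FZ FC FT G0 GZ GC GT YbZ YbC YbT Hb0 HbZ HbC HbT : ℝ}

/-! ### corner `(0,1)` -/

/-- Remainder bound `t2R01_A1` (memo §9; the inequality chain is the identity `e` plus the listed nonnegative products). -/
theorem t2R01_A1 (hFT : 0 < FT) (h0Z : F0 ≤ FZ) (hZC : FZ ≤ FC) (hCT : FC ≤ FT)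
    (g0C : G0 ≤ GC) (gCZ : GC ≤ GZ) (gZT : GZ ≤ GT)
    (hb0C : Hb0 ≤ HbC) (hbCT : HbC ≤ HbT) (yCT : YbC ≤ YbT) (sT : FT * HbT ≤ YbT) :
    0 ≤ (GT - G0) * DT0r F0 FT YbT HbC + (GZ - GC) * DZC_A1 FZ FC FT YbC HbC
      - (FC - F0) * (GC - G0) * (HbT - HbC) + (FT - FC) * (GT - GC) * (HbC - Hb0) := by
  have sl : 0 ≤ YbT / FT - HbT := by rw [sub_nonneg, le_div_iff₀ hFT]; linarith
  have e : (GT - G0) * DT0r F0 FT YbT HbC + (GZ - GC) * DZC_A1 FZ FC FT YbC HbC - (FC - F0) * (GC - G0) * (HbT - HbC)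
      = (((GT - G0) - (GZ - GC)) * (FT - F0) + (GZ - GC) * ((FT - F0) - (FC - FZ))) * (YbT / FT - HbT)
        + ((FC - F0) * (GT - GZ) + (GZ - GC) * (FZ - F0) + (GT - G0) * (FT - FC)) * (HbT - HbC)
        + (GZ - GC) * ((FC - FZ) / FT) * (YbT - YbC) := by
    unfold DT0r DZC_A1; field_simp; ring
  rw [e]
  have c1 : 0 ≤ ((GT - G0) - (GZ - GC)) * (FT - F0) + (GZ - GC) * ((FT - F0) - (FC - FZ)) := by
    have := mul_nonneg (show 0 ≤ (GT - G0) - (GZ - GC) by linarith) (show 0 ≤ FT - F0 by linarith)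
    have := mul_nonneg (sub_nonneg.2 gCZ) (show 0 ≤ (FT - F0) - (FC - FZ) by linarith); linarith
  have c2 : 0 ≤ (FC - F0) * (GT - GZ) + (GZ - GC) * (FZ - F0) + (GT - G0) * (FT - FC) := by
    have := mul_nonneg (show 0 ≤ FC - F0 by linarith) (sub_nonneg.2 gZT); have := mul_nonneg (sub_nonneg.2 gCZ) (sub_nonneg.2 h0Z)
    have := mul_nonneg (show 0 ≤ GT - G0 by linarith) (sub_nonneg.2 hCT); linarith
  have := mul_nonneg c1 sl; have := mul_nonneg c2 (sub_nonneg.2 hbCT)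
  have := mul_nonneg (mul_nonneg (sub_nonneg.2 gCZ) (div_nonneg (sub_nonneg.2 hZC) hFT.le)) (sub_nonneg.2 yCT)
  have := mul_nonneg (mul_nonneg (sub_nonneg.2 hCT) (show 0 ≤ GT - GC by linarith)) (sub_nonneg.2 hb0C)
  linarith

/-- Remainder bound `t2R01_A2` (memo §9; the inequality chain is the identity `e` plus the listed nonnegative products). -/
theorem t2R01_A2 (hFT : 0 < FT) (hFZ : 0 < FZ) (h0C : F0 ≤ FC) (hCZ : FC ≤ FZ) (hZT : FZ ≤ FT) (hCT : FC ≤ FT)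
    (g0C : G0 ≤ GC) (gCZ : GC ≤ GZ) (gZT : GZ ≤ GT)
    (hb0Z : Hb0 ≤ HbZ) (hb0C : Hb0 ≤ HbC) (hbCT : HbC ≤ HbT) (sZ : FZ * HbZ ≤ YbZ) (sT : FT * HbT ≤ YbT) :
    0 ≤ (GT - G0) * DT0r F0 FT YbT HbC + (GZ - GC) * DZC_A2 FZ FC YbZ HbC
      - (FC - F0) * (GC - G0) * (HbT - HbC) + (FT - FC) * (GT - GC) * (HbC - Hb0) := by
  have sl : 0 ≤ YbT / FT - HbT := by rw [sub_nonneg, le_div_iff₀ hFT]; linarith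
  have slZ : 0 ≤ YbZ / FZ - HbZ := by rw [sub_nonneg, le_div_iff₀ hFZ]; linarith
  have e : (GT - G0) * DT0r F0 FT YbT HbC + (GZ - GC) * DZC_A2 FZ FC YbZ HbC - (FC - F0) * (GC - G0) * (HbT - HbC)
      + (FT - FC) * (GT - GC) * (HbC - Hb0)
      = (GT - G0) * (FT - F0) * (YbT / FT - HbT) + ((FC - F0) * (GT - GC) + (GT - G0) * (FT - FC)) * (HbT - HbC)
        + (GZ - GC) * (FZ - FC) * (YbZ / FZ - HbZ) + (GZ - GC) * (FZ - FC) * (HbZ - Hb0)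
        + ((FT - FC) * (GT - GZ) + (GZ - GC) * (FT - FZ)) * (HbC - Hb0) := by
    unfold DT0r DZC_A2; field_simp; ring
  rw [e]
  have := mul_nonneg (mul_nonneg (show 0 ≤ GT - G0 by linarith) (show 0 ≤ FT - F0 by linarith)) sl
  have c2 : 0 ≤ (FC - F0) * (GT - GC) + (GT - G0) * (FT - FC) := by
    have := mul_nonneg (sub_nonneg.2 h0C) (show 0 ≤ GT - GC by linarith); have := mul_nonneg (show 0 ≤ GT - G0 by linarith) (sub_nonneg.2 hCT); linarith
  have c3 : 0 ≤ (FT - FC) * (GT - GZ) + (GZ - GC) * (FT - FZ) := by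
    have := mul_nonneg (sub_nonneg.2 hCT) (sub_nonneg.2 gZT); have := mul_nonneg (sub_nonneg.2 gCZ) (sub_nonneg.2 hZT); linarith
  have := mul_nonneg c2 (sub_nonneg.2 hbCT); have := mul_nonneg c3 (sub_nonneg.2 hb0C)
  have := mul_nonneg (mul_nonneg (sub_nonneg.2 gCZ) (sub_nonneg.2 hCZ)) slZ
  have := mul_nonneg (mul_nonneg (sub_nonneg.2 gCZ) (sub_nonneg.2 hCZ)) (sub_nonneg.2 hb0Z)
  linarith

/-- Remainder bound `t2R01_B1` (memo §9; the inequality chain is the identity `e` plus the listed nonnegative products). -/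
theorem t2R01_B1 (hFT : 0 < FT) (hFC : 0 < FC) (h0C : F0 ≤ FC) (hZC : FZ ≤ FC) (hCT : FC ≤ FT)
    (g0T : G0 ≤ GT) (gZC : GZ ≤ GC) (gCT : GC ≤ GT)
    (hb0C : Hb0 ≤ HbC) (hbCT : HbC ≤ HbT) (sC : FC * HbC ≤ YbC) (sT : FT * HbT ≤ YbT) :
    0 ≤ (GT - G0) * DT0r F0 FT YbT HbC + (GZ - GC) * DZC_B1 FZ FC YbC HbC
      - (FC - F0) * (GC - G0) * (HbT - HbC) + (FT - FC) * (GT - GC) * (HbC - Hb0) := by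
  have sl : 0 ≤ YbT / FT - HbT := by rw [sub_nonneg, le_div_iff₀ hFT]; linarith
  have slC : 0 ≤ YbC / FC - HbC := by rw [sub_nonneg, le_div_iff₀ hFC]; linarith
  have e : (GT - G0) * DT0r F0 FT YbT HbC + (GZ - GC) * DZC_B1 FZ FC YbC HbC - (FC - F0) * (GC - G0) * (HbT - HbC)
      = (GT - G0) * (FT - F0) * (YbT / FT - HbT) + ((FC - F0) * (GT - GC) + (GT - G0) * (FT - FC)) * (HbT - HbC)
        + (GC - GZ) * (FC - FZ) * (YbC / FC - HbC) := by
    unfold DT0r DZC_B1; field_simp; ring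
  rw [e]
  have := mul_nonneg (mul_nonneg (sub_nonneg.2 g0T) (show 0 ≤ FT - F0 by linarith)) sl
  have c2 : 0 ≤ (FC - F0) * (GT - GC) + (GT - G0) * (FT - FC) := by
    have := mul_nonneg (sub_nonneg.2 h0C) (sub_nonneg.2 gCT); have := mul_nonneg (sub_nonneg.2 g0T) (sub_nonneg.2 hCT); linarith
  have := mul_nonneg c2 (sub_nonneg.2 hbCT); have := mul_nonneg (mul_nonneg (sub_nonneg.2 gZC) (sub_nonneg.2 hZC)) slC
  have := mul_nonneg (mul_nonneg (sub_nonneg.2 hCT) (sub_nonneg.2 gCT)) (sub_nonneg.2 hb0C)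
  linarith

/-- Remainder bound `t2R01_B2` (memo §9; the inequality chain is the identity `e` plus the listed nonnegative products). -/
theorem t2R01_B2 (hFT : 0 < FT) (h0C : F0 ≤ FC) (hCZ : FC ≤ FZ) (hZT : FZ ≤ FT)
    (g0Z : G0 ≤ GZ) (gZC : GZ ≤ GC) (gCT : GC ≤ GT)
    (hb0C : Hb0 ≤ HbC) (hbCT : HbC ≤ HbT) (yZT : YbZ ≤ YbT) (sT : FT * HbT ≤ YbT) :
    0 ≤ (GT - G0) * DT0r F0 FT YbT HbC + (GZ - GC) * DZC_B2 FZ FC FT YbZ HbC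
      - (FC - F0) * (GC - G0) * (HbT - HbC) + (FT - FC) * (GT - GC) * (HbC - Hb0) := by
  have sl : 0 ≤ YbT / FT - HbT := by rw [sub_nonneg, le_div_iff₀ hFT]; linarith
  have e : (GT - G0) * DT0r F0 FT YbT HbC + (GZ - GC) * DZC_B2 FZ FC FT YbZ HbC - (FC - F0) * (GC - G0) * (HbT - HbC)
      = (((GT - G0) - (GC - GZ)) * (FT - F0) + (GC - GZ) * ((FT - F0) - (FZ - FC))) * (YbT / FT - HbT)
        + ((FC - F0) * (GT - GC) + (GT - G0) * (FT - FZ) + ((GT - GC) + (GZ - G0)) * (FZ - FC)) * (HbT - HbC)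
        + (GC - GZ) * ((FZ - FC) / FT) * (YbT - YbZ) := by
    unfold DT0r DZC_B2; field_simp; ring
  rw [e]
  have c1 : 0 ≤ ((GT - G0) - (GC - GZ)) * (FT - F0) + (GC - GZ) * ((FT - F0) - (FZ - FC)) := by
    have := mul_nonneg (show 0 ≤ (GT - G0) - (GC - GZ) by linarith) (show 0 ≤ FT - F0 by linarith)
    have := mul_nonneg (sub_nonneg.2 gZC) (show 0 ≤ (FT - F0) - (FZ - FC) by linarith); linarith
  have c2 : 0 ≤ (FC - F0) * (GT - GC) + (GT - G0) * (FT - FZ) + ((GT - GC) + (GZ - G0)) * (FZ - FC) := by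
    have := mul_nonneg (sub_nonneg.2 h0C) (sub_nonneg.2 gCT); have := mul_nonneg (show 0 ≤ GT - G0 by linarith) (sub_nonneg.2 hZT)
    have := mul_nonneg (show 0 ≤ (GT - GC) + (GZ - G0) by linarith) (sub_nonneg.2 hCZ); linarith
  have := mul_nonneg c1 sl; have := mul_nonneg c2 (sub_nonneg.2 hbCT)
  have := mul_nonneg (mul_nonneg (sub_nonneg.2 gZC) (div_nonneg (sub_nonneg.2 hCZ) hFT.le)) (sub_nonneg.2 yZT)
  have := mul_nonneg (mul_nonneg (show 0 ≤ FT - FC by linarith) (sub_nonneg.2 gCT)) (sub_nonneg.2 hb0C)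
  linarith

/-! ### the joint bound at corner `(0,0)` (`R_00 + R_e1 + R_e2 ≥ 0`, edge remainders abstracted as `Re1 ≥ κ_Z0(H̄_Z−H̄_0)`,
`Re2 ≥ κ_C0(H̄_C−H̄_0)`, cf. `t2edgeR`) -/

/-- The corner-`(0,0)` bookkeeping: `X·r + (κ_Z0−κ_C0)(p−q) ≥ 0` when `X ≥ κ_Z0, κ_C0 ≥ 0` and `p, q ∈ [0, r]`. -/
theorem t2corner00_aux {X kZ kC p q r : ℝ} (hZ : kZ ≤ X) (hC : kC ≤ X) (kZ0 : 0 ≤ kZ) (kC0 : 0 ≤ kC)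
    (hp : 0 ≤ p) (hq : 0 ≤ q) (pr : p ≤ r) (qr : q ≤ r) : 0 ≤ X * r + (kZ - kC) * (p - q) := by
  rcases le_total kC kZ with h | h
  · rcases le_total q p with h' | h'
    · nlinarith [mul_nonneg (sub_nonneg.2 h) (sub_nonneg.2 h'), mul_nonneg (sub_nonneg.2 hZ) (sub_nonneg.2 pr)]
    · nlinarith [mul_nonneg (sub_nonneg.2 h) (sub_nonneg.2 h'), mul_nonneg (sub_nonneg.2 hZ) (sub_nonneg.2 qr),
        mul_nonneg kC0 hq, mul_nonneg kZ0 (sub_nonneg.2 qr)]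
  · rcases le_total q p with h' | h'
    · nlinarith [mul_nonneg (sub_nonneg.2 h) (sub_nonneg.2 h'), mul_nonneg (sub_nonneg.2 hC) (sub_nonneg.2 pr),
        mul_nonneg kZ0 hp, mul_nonneg kC0 (sub_nonneg.2 pr)]
    · nlinarith [mul_nonneg (sub_nonneg.2 h) (sub_nonneg.2 h'), mul_nonneg (sub_nonneg.2 hC) (sub_nonneg.2 qr)]

/-- Remainder bound `t2R00joint_A1` (memo §9; the inequality chain is the identity `e` plus the listed nonnegative products). -/
theorem t2R00joint_A1 {Re1 Re2 : ℝ} (hFT : 0 < FT) (h0Z : F0 ≤ FZ) (hZC : FZ ≤ FC) (hCT : FC ≤ FT)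
    (g0C : G0 ≤ GC) (gCZ : GC ≤ GZ) (gZT : GZ ≤ GT)
    (hb0Z : Hb0 ≤ HbZ) (hb0C : Hb0 ≤ HbC) (hbZT : HbZ ≤ HbT) (hbCT : HbC ≤ HbT) (yCT : YbC ≤ YbT) (sT : FT * HbT ≤ YbT)
    (hRe1 : (FZ - F0) * (GZ - G0) * (HbZ - Hb0) ≤ Re1) (hRe2 : (FC - F0) * (GC - G0) * (HbC - Hb0) ≤ Re2) :
    0 ≤ (GT - G0) * DT0r F0 FT YbT Hb0 + (GZ - GC) * DZC_A1 FZ FC FT YbC Hb0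
      - (FZ - F0) * (GZ - G0) * (HbC - Hb0) - (FC - F0) * (GC - G0) * (HbZ - Hb0) + Re1 + Re2 := by
  have sl : 0 ≤ YbT / FT - HbT := by rw [sub_nonneg, le_div_iff₀ hFT]; linarith
  set X := ((GT - G0) - (GZ - GC)) * (FT - F0) + (GZ - GC) * ((FT - F0) - (FC - FZ)) with hX
  have e : (GT - G0) * DT0r F0 FT YbT Hb0 + (GZ - GC) * DZC_A1 FZ FC FT YbC Hb0
      = X * (YbT / FT - HbT) + X * (HbT - Hb0) + (GZ - GC) * ((FC - FZ) / FT) * (YbT - YbC) := by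
    rw [hX]; unfold DT0r DZC_A1; field_simp; ring
  rw [e]
  have X0 : 0 ≤ X := by
    have := mul_nonneg (show 0 ≤ (GT - G0) - (GZ - GC) by linarith) (show 0 ≤ FT - F0 by linarith)
    have := mul_nonneg (sub_nonneg.2 gCZ) (show 0 ≤ (FT - F0) - (FC - FZ) by linarith); linarith
  have XZ : (FZ - F0) * (GZ - G0) ≤ X := by
    have : X - (FZ - F0) * (GZ - G0) = (FZ - F0) * (GT - GZ) + (GT - G0) * (FT - FC) + ((GT - GZ) + (GC - G0)) * (FC - FZ) := by
      rw [hX]; ring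
    have := mul_nonneg (sub_nonneg.2 h0Z) (sub_nonneg.2 gZT); have := mul_nonneg (show 0 ≤ GT - G0 by linarith) (sub_nonneg.2 hCT)
    have := mul_nonneg (show 0 ≤ (GT - GZ) + (GC - G0) by linarith) (sub_nonneg.2 hZC); linarith
  have XC : (FC - F0) * (GC - G0) ≤ X := by
    have : X - (FC - F0) * (GC - G0) = (FC - F0) * (GT - GZ) + (GZ - GC) * (FZ - F0) + (GT - G0) * (FT - FC) := by
      rw [hX]; ring
    have := mul_nonneg (show 0 ≤ FC - F0 by linarith) (sub_nonneg.2 gZT); have := mul_nonneg (sub_nonneg.2 gCZ) (sub_nonneg.2 h0Z)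
    have := mul_nonneg (show 0 ≤ GT - G0 by linarith) (sub_nonneg.2 hCT); linarith
  have aux := t2corner00_aux (r := HbT - Hb0) (p := HbZ - Hb0) (q := HbC - Hb0) XZ XC
    (mul_nonneg (sub_nonneg.2 h0Z) (show 0 ≤ GZ - G0 by linarith)) (mul_nonneg (show 0 ≤ FC - F0 by linarith) (sub_nonneg.2 g0C))
    (sub_nonneg.2 hb0Z) (sub_nonneg.2 hb0C) (by linarith) (by linarith)
  have := mul_nonneg X0 sl
  have := mul_nonneg (mul_nonneg (sub_nonneg.2 gCZ) (div_nonneg (sub_nonneg.2 hZC) hFT.le)) (sub_nonneg.2 yCT)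
  nlinarith

/-- Remainder bound `t2R00joint_A2` (memo §9; the inequality chain is the identity `e` plus the listed nonnegative products). -/
theorem t2R00joint_A2 {Re1 Re2 : ℝ} (hFT : 0 < FT) (hFZ : 0 < FZ) (h0Z : F0 ≤ FZ) (h0C : F0 ≤ FC) (hCZ : FC ≤ FZ) (hZT : FZ ≤ FT)
    (hCT : FC ≤ FT) (g0Z : G0 ≤ GZ) (g0C : G0 ≤ GC) (gCZ : GC ≤ GZ) (gZT : GZ ≤ GT) (gCT : GC ≤ GT)
    (hb0Z : Hb0 ≤ HbZ) (hb0C : Hb0 ≤ HbC) (hbZT : HbZ ≤ HbT) (hbCT : HbC ≤ HbT) (sZ : FZ * HbZ ≤ YbZ) (sT : FT * HbT ≤ YbT)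
    (hRe1 : (FZ - F0) * (GZ - G0) * (HbZ - Hb0) ≤ Re1) (hRe2 : (FC - F0) * (GC - G0) * (HbC - Hb0) ≤ Re2) :
    0 ≤ (GT - G0) * DT0r F0 FT YbT Hb0 + (GZ - GC) * DZC_A2 FZ FC YbZ Hb0
      - (FZ - F0) * (GZ - G0) * (HbC - Hb0) - (FC - F0) * (GC - G0) * (HbZ - Hb0) + Re1 + Re2 := by
  have sl : 0 ≤ YbT / FT - HbT := by rw [sub_nonneg, le_div_iff₀ hFT]; linarith
  have slZ : 0 ≤ YbZ / FZ - HbZ := by rw [sub_nonneg, le_div_iff₀ hFZ]; linarith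
  set X := (GT - G0) * (FT - F0) with hX
  have e : (GT - G0) * DT0r F0 FT YbT Hb0 + (GZ - GC) * DZC_A2 FZ FC YbZ Hb0
      = X * (YbT / FT - HbT) + X * (HbT - Hb0) + (GZ - GC) * (FZ - FC) * (YbZ / FZ - HbZ) + (GZ - GC) * (FZ - FC) * (HbZ - Hb0) := by
    rw [hX]; unfold DT0r DZC_A2; field_simp; ring
  rw [e]
  have X0 : 0 ≤ X := mul_nonneg (show 0 ≤ GT - G0 by linarith) (show 0 ≤ FT - F0 by linarith)
  have XZ : (FZ - F0) * (GZ - G0) ≤ X := by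
    have : X - (FZ - F0) * (GZ - G0) = (FZ - F0) * (GT - GZ) + (GT - G0) * (FT - FZ) := by rw [hX]; ring
    have := mul_nonneg (sub_nonneg.2 h0Z) (sub_nonneg.2 gZT); have := mul_nonneg (show 0 ≤ GT - G0 by linarith) (sub_nonneg.2 hZT); linarith
  have XC : (FC - F0) * (GC - G0) ≤ X := by
    have : X - (FC - F0) * (GC - G0) = (FC - F0) * (GT - GC) + (GT - G0) * (FT - FC) := by rw [hX]; ring
    have := mul_nonneg (sub_nonneg.2 h0C) (sub_nonneg.2 gCT); have := mul_nonneg (show 0 ≤ GT - G0 by linarith) (sub_nonneg.2 hCT); linarith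
  have aux := t2corner00_aux (r := HbT - Hb0) (p := HbZ - Hb0) (q := HbC - Hb0) XZ XC
    (mul_nonneg (sub_nonneg.2 h0Z) (sub_nonneg.2 g0Z)) (mul_nonneg (sub_nonneg.2 h0C) (sub_nonneg.2 g0C))
    (sub_nonneg.2 hb0Z) (sub_nonneg.2 hb0C) (by linarith) (by linarith)
  have := mul_nonneg X0 sl
  have := mul_nonneg (mul_nonneg (sub_nonneg.2 gCZ) (sub_nonneg.2 hCZ)) slZ
  have := mul_nonneg (mul_nonneg (sub_nonneg.2 gCZ) (sub_nonneg.2 hCZ)) (sub_nonneg.2 hb0Z)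
  nlinarith

/-- Remainder bound `t2R00joint_B1` (memo §9; the inequality chain is the identity `e` plus the listed nonnegative products). -/
theorem t2R00joint_B1 {Re1 Re2 : ℝ} (hFT : 0 < FT) (hFC : 0 < FC) (h0Z : F0 ≤ FZ) (h0C : F0 ≤ FC) (hZC : FZ ≤ FC) (hCT : FC ≤ FT)
    (hZT : FZ ≤ FT) (g0Z : G0 ≤ GZ) (g0C : G0 ≤ GC) (gZC : GZ ≤ GC) (gZT : GZ ≤ GT) (gCT : GC ≤ GT)
    (hb0Z : Hb0 ≤ HbZ) (hb0C : Hb0 ≤ HbC) (hbZT : HbZ ≤ HbT) (hbCT : HbC ≤ HbT) (sC : FC * HbC ≤ YbC) (sT : FT * HbT ≤ YbT)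
    (hRe1 : (FZ - F0) * (GZ - G0) * (HbZ - Hb0) ≤ Re1) (hRe2 : (FC - F0) * (GC - G0) * (HbC - Hb0) ≤ Re2) :
    0 ≤ (GT - G0) * DT0r F0 FT YbT Hb0 + (GZ - GC) * DZC_B1 FZ FC YbC Hb0
      - (FZ - F0) * (GZ - G0) * (HbC - Hb0) - (FC - F0) * (GC - G0) * (HbZ - Hb0) + Re1 + Re2 := by
  have sl : 0 ≤ YbT / FT - HbT := by rw [sub_nonneg, le_div_iff₀ hFT]; linarith
  have slC : 0 ≤ YbC / FC - HbC := by rw [sub_nonneg, le_div_iff₀ hFC]; linarith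
  set X := (GT - G0) * (FT - F0) with hX
  have e : (GT - G0) * DT0r F0 FT YbT Hb0 + (GZ - GC) * DZC_B1 FZ FC YbC Hb0
      = X * (YbT / FT - HbT) + X * (HbT - Hb0) + (GC - GZ) * (FC - FZ) * (YbC / FC - HbC) + (GC - GZ) * (FC - FZ) * (HbC - Hb0) := by
    rw [hX]; unfold DT0r DZC_B1; field_simp; ring
  rw [e]
  have X0 : 0 ≤ X := mul_nonneg (show 0 ≤ GT - G0 by linarith) (show 0 ≤ FT - F0 by linarith)
  have XZ : (FZ - F0) * (GZ - G0) ≤ X := by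
    have : X - (FZ - F0) * (GZ - G0) = (FZ - F0) * (GT - GZ) + (GT - G0) * (FT - FZ) := by rw [hX]; ring
    have := mul_nonneg (sub_nonneg.2 h0Z) (sub_nonneg.2 gZT); have := mul_nonneg (show 0 ≤ GT - G0 by linarith) (sub_nonneg.2 hZT); linarith
  have XC : (FC - F0) * (GC - G0) ≤ X := by
    have : X - (FC - F0) * (GC - G0) = (FC - F0) * (GT - GC) + (GT - G0) * (FT - FC) := by rw [hX]; ring
    have := mul_nonneg (sub_nonneg.2 h0C) (sub_nonneg.2 gCT); have := mul_nonneg (show 0 ≤ GT - G0 by linarith) (sub_nonneg.2 hCT); linarith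
  have aux := t2corner00_aux (r := HbT - Hb0) (p := HbZ - Hb0) (q := HbC - Hb0) XZ XC
    (mul_nonneg (sub_nonneg.2 h0Z) (sub_nonneg.2 g0Z)) (mul_nonneg (sub_nonneg.2 h0C) (sub_nonneg.2 g0C))
    (sub_nonneg.2 hb0Z) (sub_nonneg.2 hb0C) (by linarith) (by linarith)
  have := mul_nonneg X0 sl
  have := mul_nonneg (mul_nonneg (sub_nonneg.2 gZC) (sub_nonneg.2 hZC)) slC
  have := mul_nonneg (mul_nonneg (sub_nonneg.2 gZC) (sub_nonneg.2 hZC)) (sub_nonneg.2 hb0C)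
  nlinarith

/-- Remainder bound `t2R00joint_B2` (memo §9; the inequality chain is the identity `e` plus the listed nonnegative products). -/
theorem t2R00joint_B2 {Re1 Re2 : ℝ} (hFT : 0 < FT) (h0C : F0 ≤ FC) (hCZ : FC ≤ FZ) (hZT : FZ ≤ FT)
    (g0Z : G0 ≤ GZ) (gZC : GZ ≤ GC) (gCT : GC ≤ GT)
    (hb0Z : Hb0 ≤ HbZ) (hb0C : Hb0 ≤ HbC) (hbZT : HbZ ≤ HbT) (hbCT : HbC ≤ HbT) (yZT : YbZ ≤ YbT) (sT : FT * HbT ≤ YbT)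
    (hRe1 : (FZ - F0) * (GZ - G0) * (HbZ - Hb0) ≤ Re1) (hRe2 : (FC - F0) * (GC - G0) * (HbC - Hb0) ≤ Re2) :
    0 ≤ (GT - G0) * DT0r F0 FT YbT Hb0 + (GZ - GC) * DZC_B2 FZ FC FT YbZ Hb0
      - (FZ - F0) * (GZ - G0) * (HbC - Hb0) - (FC - F0) * (GC - G0) * (HbZ - Hb0) + Re1 + Re2 := by
  have sl : 0 ≤ YbT / FT - HbT := by rw [sub_nonneg, le_div_iff₀ hFT]; linarith
  set X := ((GT - G0) - (GC - GZ)) * (FT - F0) + (GC - GZ) * ((FT - F0) - (FZ - FC)) with hX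
  have e : (GT - G0) * DT0r F0 FT YbT Hb0 + (GZ - GC) * DZC_B2 FZ FC FT YbZ Hb0
      = X * (YbT / FT - HbT) + X * (HbT - Hb0) + (GC - GZ) * ((FZ - FC) / FT) * (YbT - YbZ) := by
    rw [hX]; unfold DT0r DZC_B2; field_simp; ring
  rw [e]
  have X0 : 0 ≤ X := by
    have := mul_nonneg (show 0 ≤ (GT - G0) - (GC - GZ) by linarith) (show 0 ≤ FT - F0 by linarith)
    have := mul_nonneg (sub_nonneg.2 gZC) (show 0 ≤ (FT - F0) - (FZ - FC) by linarith); linarith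
  have XZ : (FZ - F0) * (GZ - G0) ≤ X := by
    have : X - (FZ - F0) * (GZ - G0) = (FZ - F0) * (GT - GC) + (GC - GZ) * (FC - F0) + (GT - G0) * (FT - FZ) := by rw [hX]; ring
    have := mul_nonneg (show 0 ≤ FZ - F0 by linarith) (show 0 ≤ GT - GC by linarith); have := mul_nonneg (sub_nonneg.2 gZC) (sub_nonneg.2 h0C)
    have := mul_nonneg (show 0 ≤ GT - G0 by linarith) (sub_nonneg.2 hZT); linarith
  have XC : (FC - F0) * (GC - G0) ≤ X := by
    have : X - (FC - F0) * (GC - G0) = (FC - F0) * (GT - GC) + (GT - G0) * (FT - FZ) + ((GT - GC) + (GZ - G0)) * (FZ - FC) := by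
      rw [hX]; ring
    have := mul_nonneg (sub_nonneg.2 h0C) (sub_nonneg.2 gCT); have := mul_nonneg (show 0 ≤ GT - G0 by linarith) (sub_nonneg.2 hZT)
    have := mul_nonneg (show 0 ≤ (GT - GC) + (GZ - G0) by linarith) (sub_nonneg.2 hCZ); linarith
  have aux := t2corner00_aux (r := HbT - Hb0) (p := HbZ - Hb0) (q := HbC - Hb0) XZ XC
    (mul_nonneg (show 0 ≤ FZ - F0 by linarith) (sub_nonneg.2 g0Z)) (mul_nonneg (sub_nonneg.2 h0C) (show 0 ≤ GC - G0 by linarith))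
    (sub_nonneg.2 hb0Z) (sub_nonneg.2 hb0C) (by linarith) (by linarith)
  have := mul_nonneg X0 sl
  have := mul_nonneg (mul_nonneg (sub_nonneg.2 gZC) (div_nonneg (sub_nonneg.2 hCZ) hFT.le)) (sub_nonneg.2 yZT)
  nlinarith

end Corner00

end SahiT2Square

end Summit.CriticalPhenomena.PercolationContinuityZ3.Theorems
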